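import Literature.NumberTheory.EllipticCurves.TianYuanZhang2017.CongruentRealPeriodProofs
import Literature.NumberTheory.EllipticCurves.CongruentNumberCurveTamagawaProofs
import Literature.NumberTheory.EllipticCurves.CongruentNumberCurveTorsionProofs
import Literature.NumberTheory.EllipticCurves.RegulatorProofs
import Literature.NumberTheory.EllipticCurves.LeadingTermProofs
import HarnessLib

/-!
# Tian–Yuan–Zhang 2017, formula (1.1): `BSD(E_n) ⟺ #Ш(E_n) = 𝓛(n)²` — the normalisation remark PROVED

HONEST FRAMING (cell `b2b-bsdres`, sub-lane `bsd-p2`, literature typer 1, registry row A267): this is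
a PROOFS-ONLY sibling of `GenusPeriodsParity.lean` (0 definitions, 0 named facts, nothing asserted,
nothing booked, no mark moved). It turns the authors' unproved sentence "The definition [of `𝓛(n)`]
is made so that the full BSD conjecture for `E_n` in the case `ord_{s=1} L(E_n,s) ≤ 1` writes as
(1.1) `#Ш(E_n) = 𝓛(n)²`" [TianYuanZhang2017, §1, chunk p0002 L71–L75 of the held text
`paper:arxiv-1411.4728`] — vendored as the named `Prop`
`TianYuanZhang2017.bsd_iff_cardSha_eq_scriptLSq` with a CONSUMER WARNING precisely because no proof
is printed — into tree THEOREMS, assembled from the three arithmetic legs now proved in the tree for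
every square-free `n`:

* `Ω(E_n) = Ω_{n,∞}`: `realPeriodRat_congruentNumberCurve` (`CongruentRealPeriodProofs.lean`);
* `∏_p c_p(E_n) = 2^{2k(n)+2−a(n)}`: `tamagawaProduct_congruentNumberCurve_eq_two_pow`
  (`CongruentNumberCurveTamagawaProofs.lean`, Tate's algorithm on `y² = x³ − n²x`);
* `#E_n(ℚ)_tors = 4`: `torsionOrder_congruentNumberCurve` (`CongruentNumberCurveTorsionProofs.lean`);

together with `R_n = Reg(E_n)` (by definition, `regulatorTYZ`; the height normalisation is discussed
in `GenusPeriodsParity.lean`) and `Reg(E_n) = 1` in rank `0` (`regulator_eq_one_of_rank_zero`,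
Mordell–Weil proved in the tree).

## Results

* `tamagawaProduct_div_torsionOrder_sq`: `∏_p c_p(E_n) / #E_n(ℚ)_tors² = 2^{2k(n)−2−a(n)}`, i.e. the
  tree's BSD right-hand side of the global minimal model `congruentNumberCurve n` is
  `#Ш · Reg(E_n) · 2^{2k(n)−2−a(n)} Ω_{n,∞}` (`bsdRHS_congruentNumberCurve`).
* `bsd_iff_cardSha_eq_scriptLSq_of_analyticRank_eq_one` — **unconditional**: for square-free `n`
  with `ord_{s=1} L(E_n,s) = 1`, `(Ш(E_n) finite ∧ LEAD(E_n)) ⟺ (Ш(E_n) finite ∧ #Ш(E_n) = 𝓛(n)²)`.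
  (Both sides carry the finiteness of `Ш`; `L′(E_n,1) ≠ 0` is
  `leadingLCoeff_ne_zero_of_analyticRank_ne_zero`, so a vanishing regulator makes both sides false.)
* `bsd_iff_cardSha_eq_scriptLSq_of_analyticRank_eq_zero` — for `ord_{s=1} L(E_n,s) = 0` the same
  equivalence GIVEN `rank E_n(ℚ) = 0` (the one input not in the tree: it is Gross–Zagier–Kolyvagin,
  or Coates–Wiles for these CM curves; with it `Reg(E_n) = 1`, while `𝓛(n)²` in rank `0` carries no
  regulator).
* `bsd_iff_cardSha_eq_scriptLSq_of_bsdRankFormula`, `bsdTriple_iff_rank_and_cardSha_eq_scriptLSq`: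
  per-`n` packaging — for `ord_{s=1} L(E_n,s) ≤ 1`, `BSDTriple(E_n) ⟺ (RANK(E_n) ∧ #Ш(E_n) = 𝓛(n)²)`.
* `bsd_iff_cardSha_eq_scriptLSq_of_GZK`: the vendored `Prop` AS PRINTED, modulo the ONE displayed
  journal fact `rank_eq_analyticRank_of_analyticRank_le_one` (Gross–Zagier–Kolyvagin, bsd.S17).
  There is deliberately no `bsd_iff_cardSha_eq_scriptLSq_holds`: the rank-`0` half needs
  `rank E_n(ℚ) = 0`, which the tree does not prove.

The CONSUMER WARNING on the `Prop` stands as written (do not ASSUME it); these theorems are what a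
consumer uses instead.

## References

* [TianYuanZhang2017] Y. Tian, X. Yuan, S.-W. Zhang, *Genus periods, genus points and congruent
  number problem*, Asian J. Math. 21 (2017) 721–774 = arXiv:1411.4728, §1, (1.1) and the sentence
  preceding it (held text chunk p0002 L46–L75).
* [Darmon2004] H. Darmon, *Rational points on modular elliptic curves*, CBMS 101 (2004), Thm. 3.22
  (Gross–Zagier–Kolyvagin), for the hypothesis of `bsd_iff_cardSha_eq_scriptLSq_of_GZK`.
* [SilvermanAEC2009] J. H. Silverman, *The Arithmetic of Elliptic Curves*, 2nd ed., C.16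
  (the BSD formula; `Reg = 1` in rank `0`, VIII.9).
-/

noncomputable section

open scoped Classical

open WeierstrassCurve Literature.NumberTheory.EllipticCurves

namespace Literature.NumberTheory.EllipticCurves.TianYuanZhang2017

variable {n : ℕ}

/-! ### The normalisation `∏_p c_p / #E_n(ℚ)_tors² = 2^{2k(n)−2−a(n)}` -/

/-- Exponent bookkeeping: `2k(n) − 2 − a(n) = (2k(n) + 2 − a(n)) − 4`. [folklore] -/
private theorem twoExponent_eq (n : ℕ) :
    twoExponent n =
      ((2 * (n.primeFactors.filter Odd).card + 2 - (if Even n then 0 else 1) : ℕ) : ℤ) - 4 := by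
  unfold twoExponent oddPrimeFactorCount oddIndicator
  split_ifs with h
  · push_cast
    ring
  · have h' : 2 * (n.primeFactors.filter Odd).card + 2 - 1 =
        2 * (n.primeFactors.filter Odd).card + 1 := by
      omega
    rw [h']
    push_cast
    ring

/-- **`∏_p c_p(E_n) / #E_n(ℚ)_tors² = 2^{2k(n)−2−a(n)}`** for square-free `n` (in `ℂ`, the exponent an
integer: `−3` for `n = 1`): the Tamagawa product `2^{2k(n)+2−a(n)}`
(`tamagawaProduct_congruentNumberCurve_eq_two_pow`) over `#E_n(ℚ)_tors² = 16`
(`torsionOrder_congruentNumberCurve`). This is the arithmetic content of the power of `2` in the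
authors' definition of `𝓛(n)`.
[cite: TianYuanZhang2017, §1, definition of 𝓛(n) and (1.1) (arXiv:1411.4728 chunk p0002 L46–L75)] -/
theorem tamagawaProduct_div_torsionOrder_sq (hsq : Squarefree n) :
    ((congruentNumberCurve n).tamagawaProduct : ℂ) /
        ((congruentNumberCurve n).torsionOrder : ℂ) ^ 2 = (2 : ℂ) ^ twoExponent n := by
  rw [tamagawaProduct_congruentNumberCurve_eq_two_pow hsq, torsionOrder_congruentNumberCurve hsq,
    twoExponent_eq, zpow_sub₀ (two_ne_zero' ℂ), zpow_natCast]
  push_cast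
  norm_num

/-- **The BSD right-hand side of `E_n` in the authors' currency**: for square-free `n`,
`#Ш · Reg · Ω · ∏ c_p / #tors²` of the global minimal model `congruentNumberCurve n` equals
`#Ш(E_n) · Reg(E_n) · (2^{2k(n)−2−a(n)} Ω_{n,∞})` (`Ω(E_n) = Ω_{n,∞}` by
`realPeriodRat_congruentNumberCurve`, and `tamagawaProduct_div_torsionOrder_sq`).
[cite: TianYuanZhang2017, §1, (1.1) and the sentence preceding it (arXiv:1411.4728 chunk p0002 L71–L75)] -/
theorem bsdRHS_congruentNumberCurve (hsq : Squarefree n) :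
    ((congruentNumberCurve n).bsdRHS : ℂ) =
      ((congruentNumberCurve n).shaOrder : ℂ) * ((congruentNumberCurve n).regulator : ℂ) *
        ((2 : ℂ) ^ twoExponent n * (realPeriodTYZ n : ℂ)) := by
  have hn : 0 < n := Nat.pos_of_ne_zero hsq.ne_zero
  rw [bsdRHS_def, realPeriodRat_congruentNumberCurve hn, ← tamagawaProduct_div_torsionOrder_sq hsq]
  push_cast
  ring

/-- `Ω_{n,∞} > 0` for square-free `n` (it is the real period of the elliptic curve `E_n`,
`realPeriod_pos'`). [folklore] -/
private theorem realPeriodTYZ_pos (hsq : Squarefree n) : 0 < realPeriodTYZ n := by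
  have hn : 0 < n := Nat.pos_of_ne_zero hsq.ne_zero
  haveI := isElliptic_congruentNumberCurve hsq.ne_zero
  haveI : ((congruentNumberCurve n).baseChange ℝ).IsElliptic := by
    rw [WeierstrassCurve.baseChange]
    infer_instance
  rw [← realPeriodRat_congruentNumberCurve hn, WeierstrassCurve.realPeriodRat]
  exact ((congruentNumberCurve n).baseChange ℝ).realPeriod_pos'

/-- The denominator `2^{2k(n)−2−a(n)} Ω_{n,∞}` of `𝓛(n)²` is nonzero. [folklore] -/
private theorem twoPow_mul_realPeriodTYZ_ne_zero (hsq : Squarefree n) :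
    (2 : ℂ) ^ twoExponent n * (realPeriodTYZ n : ℂ) ≠ 0 :=
  mul_ne_zero (zpow_ne_zero _ (two_ne_zero' ℂ))
    (by exact_mod_cast (realPeriodTYZ_pos hsq).ne')

/-! ### `𝓛(n)²` in analytic ranks `0` and `1` (unfolding) -/

/-- In analytic rank `0`: `𝓛(n)² = L(E_n,1) / (2^{2k(n)−2−a(n)} Ω_{n,∞})`.
[cite: TianYuanZhang2017, §1, definition of 𝓛(n), first case (arXiv:1411.4728 chunk p0002 L46–L53)] -/
theorem scriptLSq_of_analyticRank_eq_zero (h0 : (congruentNumberCurve n).analyticRank = 0) :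
    scriptLSq n = (congruentNumberCurve n).leadingLCoeff /
      ((2 : ℂ) ^ twoExponent n * (realPeriodTYZ n : ℂ)) := by
  unfold scriptLSq
  rw [if_pos h0]

/-- In analytic rank `1`: `𝓛(n)² = L′(E_n,1) / (2^{2k(n)−2−a(n)} Ω_{n,∞} R_n)` with `R_n = Reg(E_n)`.
[cite: TianYuanZhang2017, §1, definition of 𝓛(n), second case (arXiv:1411.4728 chunk p0002 L54–L69)] -/
theorem scriptLSq_of_analyticRank_eq_one (h1 : (congruentNumberCurve n).analyticRank = 1) :
    scriptLSq n = (congruentNumberCurve n).leadingLCoeff /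
      ((2 : ℂ) ^ twoExponent n * (realPeriodTYZ n : ℂ) * ((congruentNumberCurve n).regulator : ℂ)) := by
  unfold scriptLSq regulatorTYZ
  rw [if_neg (by rw [h1]; exact one_ne_zero), if_pos h1]

/-! ### (1.1) in analytic rank one — unconditional -/

/-- **TYZ (1.1) in analytic rank one, PROVED.** For square-free `n` with `ord_{s=1} L(E_n,s) = 1`:
`(Ш(E_n) finite ∧ L′(E_n,1) = #Ш·Reg·Ω·∏c_p/#tors²) ⟺ (Ш(E_n) finite ∧ #Ш(E_n) = 𝓛(n)²)`, for the
global minimal model `congruentNumberCurve n` and the tree's `ShaFinite` / `BSDLeadingTermFormula`.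
Proof: `bsdRHS_congruentNumberCurve` and `scriptLSq_of_analyticRank_eq_one`; if `Reg(E_n) ≠ 0`
the two equations are the same identity solved for different unknowns; if `Reg(E_n) = 0` both
sides are false (`L′(E_n,1) ≠ 0` by `leadingLCoeff_ne_zero_of_analyticRank_ne_zero`, and
`#Ш ≥ 1` for finite `Ш` while `𝓛(n)² = L′/0 = 0`). No hypothesis beyond the printed ones.
[cite: TianYuanZhang2017, §1, (1.1) and the sentence preceding it (arXiv:1411.4728 chunk p0002 L71–L75)] -/
theorem bsd_iff_cardSha_eq_scriptLSq_of_analyticRank_eq_one (hsq : Squarefree n)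
    (h1 : (congruentNumberCurve n).analyticRank = 1) :
    ((congruentNumberCurve n).ShaFinite ∧ (congruentNumberCurve n).BSDLeadingTermFormula) ↔
      cardSha_eq_scriptLSq n := by
  unfold cardSha_eq_scriptLSq WeierstrassCurve.ShaFinite WeierstrassCurve.BSDLeadingTermFormula
  refine and_congr_right fun hfin => ?_
  have hS : 0 < (congruentNumberCurve n).shaOrder := (congruentNumberCurve n).shaOrder_pos hfin
  have hL : (congruentNumberCurve n).leadingLCoeff ≠ 0 :=
    leadingLCoeff_ne_zero_of_analyticRank_ne_zero _ (by rw [h1]; exact one_ne_zero)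
  have hD := twoPow_mul_realPeriodTYZ_ne_zero hsq
  rw [scriptLSq_of_analyticRank_eq_one h1, bsdRHS_congruentNumberCurve hsq]
  change _ ↔ (((congruentNumberCurve n).shaOrder : ℕ) : ℂ) = _
  by_cases hR : (congruentNumberCurve n).regulator = 0
  · rw [hR, Complex.ofReal_zero, mul_zero, zero_mul, mul_zero, div_zero]
    exact iff_of_false hL (by exact_mod_cast hS.ne')
  · have hDR : (2 : ℂ) ^ twoExponent n * (realPeriodTYZ n : ℂ) *
        ((congruentNumberCurve n).regulator : ℂ) ≠ 0 :=
      mul_ne_zero hD (by exact_mod_cast hR)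
    rw [eq_div_iff hDR]
    constructor
    · intro h
      rw [h]
      ring
    · intro h
      rw [← h]
      ring

/-! ### (1.1) in analytic rank zero — given `rank E_n(ℚ) = 0` -/

/-- **TYZ (1.1) in analytic rank zero, given `rank E_n(ℚ) = 0`.** For square-free `n` with
`ord_{s=1} L(E_n,s) = 0` and `rank_ℤ E_n(ℚ) = 0`:
`(Ш(E_n) finite ∧ L(E_n,1) = #Ш·Reg·Ω·∏c_p/#tors²) ⟺ (Ш(E_n) finite ∧ #Ш(E_n) = 𝓛(n)²)`.
The rank hypothesis gives `Reg(E_n) = 1` (`regulator_eq_one_of_rank_zero`; the authors' `𝓛(n)` has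
no regulator in rank `0`); it is supplied by Gross–Zagier–Kolyvagin
(`bsd_iff_cardSha_eq_scriptLSq_of_GZK`) or, for these CM curves, by Coates–Wiles, neither of which
is proved in the tree.
[cite: TianYuanZhang2017, §1, (1.1) and the sentence preceding it (arXiv:1411.4728 chunk p0002 L71–L75)] -/
theorem bsd_iff_cardSha_eq_scriptLSq_of_analyticRank_eq_zero (hsq : Squarefree n)
    (h0 : (congruentNumberCurve n).analyticRank = 0)
    (hrk : (congruentNumberCurve n).mordellWeilRank = 0) :
    ((congruentNumberCurve n).ShaFinite ∧ (congruentNumberCurve n).BSDLeadingTermFormula) ↔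
      cardSha_eq_scriptLSq n := by
  haveI := isElliptic_congruentNumberCurve hsq.ne_zero
  have hR : (congruentNumberCurve n).regulator = 1 :=
    (congruentNumberCurve n).regulator_eq_one_of_rank_zero hrk
  unfold cardSha_eq_scriptLSq WeierstrassCurve.ShaFinite WeierstrassCurve.BSDLeadingTermFormula
  refine and_congr_right fun _ => ?_
  have hD := twoPow_mul_realPeriodTYZ_ne_zero hsq
  rw [scriptLSq_of_analyticRank_eq_zero h0, bsdRHS_congruentNumberCurve hsq, hR, Complex.ofReal_one,
    mul_one]
  change _ ↔ (((congruentNumberCurve n).shaOrder : ℕ) : ℂ) = _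
  rw [eq_div_iff hD]
  constructor
  · intro h
    rw [h]
  · intro h
    rw [← h]

/-! ### Packaging: analytic rank `≤ 1` -/

/-- For square-free `n` with `ord_{s=1} L(E_n,s) ≤ 1` and RANK(`E_n`) (`r_an = rank`, the tree's
`BSDRankFormula`): `(SHAFIN ∧ LEAD)(E_n) ⟺ #Ш(E_n) = 𝓛(n)²` (with `Ш` finite).
[cite: TianYuanZhang2017, §1, (1.1) and the sentence preceding it (arXiv:1411.4728 chunk p0002 L71–L75)] -/
theorem bsd_iff_cardSha_eq_scriptLSq_of_bsdRankFormula (hsq : Squarefree n)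
    (hle : (congruentNumberCurve n).analyticRank ≤ 1)
    (hrank : (congruentNumberCurve n).BSDRankFormula) :
    ((congruentNumberCurve n).ShaFinite ∧ (congruentNumberCurve n).BSDLeadingTermFormula) ↔
      cardSha_eq_scriptLSq n := by
  rcases Nat.le_one_iff_eq_zero_or_eq_one.mp hle with h0 | h1
  · exact bsd_iff_cardSha_eq_scriptLSq_of_analyticRank_eq_zero hsq h0 (hrank.symm.trans h0)
  · exact bsd_iff_cardSha_eq_scriptLSq_of_analyticRank_eq_one hsq h1

/-- **Full BSD for `E_n` in the authors' currency.** For square-free `n` with `ord_{s=1} L(E_n,s) ≤ 1`: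
`BSDTriple(E_n)` (RANK ∧ SHAFIN ∧ LEAD for the global minimal model `congruentNumberCurve n`)
`⟺ RANK(E_n) ∧ (Ш(E_n) finite ∧ #Ш(E_n) = 𝓛(n)²)`.
[cite: TianYuanZhang2017, §1, (1.1) and the sentence preceding it (arXiv:1411.4728 chunk p0002 L71–L75)] -/
theorem bsdTriple_iff_rank_and_cardSha_eq_scriptLSq (hsq : Squarefree n)
    (hle : (congruentNumberCurve n).analyticRank ≤ 1) :
    (congruentNumberCurve n).BSDTriple ↔
      ((congruentNumberCurve n).BSDRankFormula ∧ cardSha_eq_scriptLSq n) := by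
  unfold WeierstrassCurve.BSDTriple
  exact and_congr_right fun hrank => bsd_iff_cardSha_eq_scriptLSq_of_bsdRankFormula hsq hle hrank

/-! ### The vendored `Prop` modulo Gross–Zagier–Kolyvagin -/

/-- **`TianYuanZhang2017.bsd_iff_cardSha_eq_scriptLSq` modulo GZK.** The printed normalisation claim
(for every square-free `n` with `ord_{s=1} L(E_n,s) ≤ 1`, `(SHAFIN ∧ LEAD)(E_n) ⟺ #Ш(E_n) = 𝓛(n)²`)
follows from the single displayed fact `rank_eq_analyticRank_of_analyticRank_le_one`
(Gross–Zagier–Kolyvagin: `r_an ≤ 1 ⟹ rank = r_an`), used only in analytic rank `0` (for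
`Reg(E_n) = 1`); the analytic-rank-`1` half is unconditional
(`bsd_iff_cardSha_eq_scriptLSq_of_analyticRank_eq_one`). Not a `_holds`: the tree does not prove GZK.
[cite: TianYuanZhang2017, §1, (1.1) and the sentence preceding it (arXiv:1411.4728 chunk p0002 L71–L75); Darmon2004, Thm. 3.22] -/
theorem bsd_iff_cardSha_eq_scriptLSq_of_GZK (hGZK : rank_eq_analyticRank_of_analyticRank_le_one) :
    bsd_iff_cardSha_eq_scriptLSq := by
  intro n _ _ hsq hle
  rcases Nat.le_one_iff_eq_zero_or_eq_one.mp hle with h0 | h1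
  · exact bsd_iff_cardSha_eq_scriptLSq_of_analyticRank_eq_zero hsq h0
      ((hGZK (congruentNumberCurve n) hle).1.trans h0)
  · exact bsd_iff_cardSha_eq_scriptLSq_of_analyticRank_eq_one hsq h1

end Literature.NumberTheory.EllipticCurves.TianYuanZhang2017

end
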